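import Literature.Probability.RandomPlanarGeometry.SLETransienceFromTraceExistence
import Literature.Probability.RandomPlanarGeometry.CritPercSLESpaceFillingOfTransience
import HarnessLib

/-!
# The space-filling phase of SLE (Rohde–Schramm (2005), Cor. 7.4) from the two trace-existence inputs

Topic `Probability/RandomPlanarGeometry`; theorems only, nothing is redefined and no named fact is
introduced. Bookkeeping on the named fact
`Literature.Probability.RandomPlanarGeometry.ae_isSpaceFilling_sleTrace_of_eight_le`
(`CritPercSLE.lean`; S. Rohde, O. Schramm, *Basic properties of SLE*, Ann. of Math. 161 (2005),
Cor. 7.4: "Suppose that `κ > 8`, then `γ[0, ∞) = ℍ̄` a.s.", with the Update (p. 911): "Corollary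
7.4 and Theorem 7.1 are true also for `κ = 8` [LSW]").

The printed proof (p. 911) — "`γ[0, ∞)` is dense in `ℍ` by Lemma 6.3 and (6.2); and it is closed
in `ℂ` since `γ` is transient, by Theorem 7.1" — is proved in the tree
(`CritPercSLESpaceFillingOfTransience`: `ae_isSpaceFilling_sleTrace_of_ae_tendsto_norm_atTop`,
resting on the proved Lemma 6.3 for `κ ≥ 8`, `tendsto_sleDerivRatio_atTop_of_eight_le_holds`, and
the proved density `ae_subset_closure_range_sleTrace_of_hasSLETrace`), and so is, since
`SLETransienceFromTraceExistence`, all of Rohde–Schramm's §7 below the two inputs through which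
the SLE trace exists at all:

* `RohdeSchramm2005_cor35 preWienerMeasure` — Rohde–Schramm's derivative estimate Cor. 3.5
  (whence Thm. 5.1, the trace for `κ ≠ 8`, `hasSLETrace_of_ne_eight_of_cor35`, and the null area of
  `∂Kₜ` behind the `κ ≥ 8` branch of Lemma 7.3, `ae_volume_frontier_sleHull_eq_zero_of_cor35`);
* `hasSLETrace_eight` — Lawler–Schramm–Werner (2004), Thm. 4.7: SLE₈ is generated by a curve.

This file records the resulting reductions of Cor. 7.4:

* `ae_isSpaceFilling_sleTrace_of_cor35_of_hasSLETrace` — **given Cor. 3.5, for every `κ ≥ 8`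
  at which SLE_κ is generated by a curve, the trace is a.s. space-filling**; conversely a.s.
  space-filling forces `HasSLETrace κ` outright (`hasSLETrace_of_ae_isSpaceFilling_sleTrace`), so
  given Cor. 3.5 the two are *equivalent* at each `κ ≥ 8`
  (`ae_isSpaceFilling_sleTrace_iff_hasSLETrace_of_cor35`);
* `ae_isSpaceFilling_sleTrace_of_cor35_of_eight_lt` — **Cor. 7.4 as printed (`κ > 8`) follows
  from Cor. 3.5 alone** (Lawler–Schramm–Werner's theorem is not involved), and so does the named
  fact at every `κ ≠ 8` (`ae_isSpaceFilling_sleTrace_of_eight_le_of_cor35_of_ne_eight`);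
* `ae_isSpaceFilling_sleTrace_of_eight_le_of_cor35_of_hasSLETrace_eight` — **the named fact from
  the two inputs**, and, given Cor. 3.5, its *equivalence* with `hasSLETrace_eight`
  (`ae_isSpaceFilling_sleTrace_of_eight_le_eight_iff_of_cor35` at `κ = 8`,
  `forall_ae_isSpaceFilling_sleTrace_of_eight_le_iff_of_cor35` for the fact at every `κ`), with
  the transience fact `tendsto_norm_sleTrace_atTop`
  (`forall_ae_isSpaceFilling_sleTrace_of_eight_le_iff_tendsto_norm_sleTrace_atTop_of_cor35`) and
  with the existence of the chordal SLE curves `exists_isSLECurve`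
  (`forall_ae_isSpaceFilling_sleTrace_of_eight_le_iff_exists_isSLECurve_of_cor35`).

So `ae_isSpaceFilling_sleTrace_of_eight_le` rests on exactly the named facts
`RohdeSchramm2005_cor35` and `hasSLETrace_eight`, and entails the second.

## References

* S. Rohde, O. Schramm, *Basic properties of SLE*, Ann. of Math. 161 (2005) 883–924
  (arXiv:math/0106036): Cor. 7.4 and its proof (p. 911), Thm. 7.1, Lemma 7.3, Lemma 6.3 and
  eq. (6.2), Cor. 3.5, Thm. 5.1, Update (p. 911).
* G. F. Lawler, O. Schramm, W. Werner, *Conformal invariance of planar loop-erased random walks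
  and uniform spanning trees*, Ann. Probab. 32 (2004) 939–995, Thm. 4.7.
-/

noncomputable section

open Filter MeasureTheory
open scoped NNReal

namespace Literature.Probability.RandomPlanarGeometry

open Loewner

variable {κ : ℝ≥0}

/-! ### One `κ ≥ 8` at a time, from Cor. 3.5 -/

/-- **Given Rohde–Schramm's Cor. 3.5: for `κ ≥ 8`, if SLE_κ is generated by a curve then a.s.
`γ[0, ∞) = ℍ̄`.** Transience at `κ` is Thm. 7.1 with the Update from Cor. 3.5 and the trace (for
`κ > 8`, `tendsto_norm_sleTrace_atTop_of_cor35_of_ne_eight`: the `κ ≥ 8` branch of Lemma 7.3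
through the null area of the hull boundary; at `κ = 8` the hypothesis is `hasSLETrace_eight` and
`tendsto_norm_sleTrace_atTop_of_cor35_of_eight` applies); then Cor. 7.4 at `κ`
(`ae_isSpaceFilling_sleTrace_of_ae_tendsto_norm_atTop`: dense by Lemma 6.3 and (6.2), closed by
transience). The hypothesis `HasSLETrace κ` is automatic for `κ > 8`
(`hasSLETrace_of_ne_eight_of_cor35`) and is Lawler–Schramm–Werner's Thm. 4.7 at `κ = 8`.
[cite: RohdeSchramm2005, Cor. 7.4 and Update (p. 911)] -/
theorem ae_isSpaceFilling_sleTrace_of_cor35_of_hasSLETrace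
    (h35 : RohdeSchramm2005_cor35 Process.preWienerMeasure) (hκ : 8 ≤ κ) (h0 : HasSLETrace κ) :
    ∀ᵐ ω ∂Process.preWienerMeasure, IsSpaceFilling (sleTrace κ ω) := by
  refine ae_isSpaceFilling_sleTrace_of_ae_tendsto_norm_atTop hκ ?_
  rcases hκ.eq_or_lt with h8 | hgt
  · subst h8
    exact tendsto_norm_sleTrace_atTop_of_cor35_of_eight h35 h0 (by norm_num)
  · exact tendsto_norm_sleTrace_atTop_of_cor35_of_ne_eight h35 (lt_trans (by norm_num) hgt)
      (ne_of_gt hgt)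

/-- **Given Cor. 3.5, for `κ ≥ 8`: a.s. `γ[0, ∞) = ℍ̄` iff SLE_κ is generated by a curve.**
`→` holds outright (`hasSLETrace_of_ae_isSpaceFilling_sleTrace`: the junk trace of a chain not
generated by a curve is constant, so not space-filling); `←` is
`ae_isSpaceFilling_sleTrace_of_cor35_of_hasSLETrace`. [cite: RohdeSchramm2005, Cor. 7.4 and Thm 5.1] -/
theorem ae_isSpaceFilling_sleTrace_iff_hasSLETrace_of_cor35
    (h35 : RohdeSchramm2005_cor35 Process.preWienerMeasure) (hκ : 8 ≤ κ) :
    (∀ᵐ ω ∂Process.preWienerMeasure, IsSpaceFilling (sleTrace κ ω)) ↔ HasSLETrace κ :=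
  ⟨hasSLETrace_of_ae_isSpaceFilling_sleTrace,
    ae_isSpaceFilling_sleTrace_of_cor35_of_hasSLETrace h35 hκ⟩

/-- **Cor. 7.4 as printed — "Suppose that `κ > 8`, then `γ[0, ∞) = ℍ̄` a.s." — from
Rohde–Schramm's Cor. 3.5 alone**: for `κ > 8` the trace exists by Thm. 5.1
(`hasSLETrace_of_ne_eight_of_cor35`); then `ae_isSpaceFilling_sleTrace_of_cor35_of_hasSLETrace`.
Lawler–Schramm–Werner's SLE₈ theorem is not involved. [cite: RohdeSchramm2005, Cor. 7.4] -/
theorem ae_isSpaceFilling_sleTrace_of_cor35_of_eight_lt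
    (h35 : RohdeSchramm2005_cor35 Process.preWienerMeasure) (hκ : 8 < κ) :
    ∀ᵐ ω ∂Process.preWienerMeasure, IsSpaceFilling (sleTrace κ ω) :=
  ae_isSpaceFilling_sleTrace_of_cor35_of_hasSLETrace h35 hκ.le
    (hasSLETrace_of_ne_eight_of_cor35 h35 (ne_of_gt hκ))

/-- **The named fact at every `κ ≠ 8` from Cor. 3.5 alone** (vacuous for `κ < 8`, Cor. 7.4 as
printed for `κ > 8`). [cite: RohdeSchramm2005, Cor. 7.4] -/
theorem ae_isSpaceFilling_sleTrace_of_eight_le_of_cor35_of_ne_eight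
    (h35 : RohdeSchramm2005_cor35 Process.preWienerMeasure) (hκ8 : κ ≠ 8) :
    ae_isSpaceFilling_sleTrace_of_eight_le (κ := κ) :=
  fun hκ ↦ ae_isSpaceFilling_sleTrace_of_cor35_of_eight_lt h35 (lt_of_le_of_ne hκ (Ne.symm hκ8))

/-! ### The named fact from the two inputs -/

/-- **`ae_isSpaceFilling_sleTrace_of_eight_le` from the two trace-existence inputs**:
Rohde–Schramm's Cor. 3.5 (`RohdeSchramm2005_cor35`) and Lawler–Schramm–Werner's Thm. 4.7
(`hasSLETrace_eight`), through Thm. 7.1 with the Update from the same two inputs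
(`tendsto_norm_sleTrace_atTop_of_cor35_of_eight`) and Cor. 7.4 from transience
(`ae_isSpaceFilling_sleTrace_of_eight_le_of_tendsto_norm_sleTrace_atTop`). Everything else —
Lemma 6.3 and (6.2), §7 of Rohde–Schramm below Cor. 3.5, the Loewner theory — is proved in the
tree. [cite: RohdeSchramm2005, Cor. 7.4 and Update (p. 911); LawlerSchrammWerner2004, Thm 4.7] -/
theorem ae_isSpaceFilling_sleTrace_of_eight_le_of_cor35_of_hasSLETrace_eight
    (h35 : RohdeSchramm2005_cor35 Process.preWienerMeasure) (h8e : hasSLETrace_eight) :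
    ae_isSpaceFilling_sleTrace_of_eight_le (κ := κ) :=
  ae_isSpaceFilling_sleTrace_of_eight_le_of_tendsto_norm_sleTrace_atTop
    (tendsto_norm_sleTrace_atTop_of_cor35_of_eight h35 h8e)

/-- **Given Cor. 3.5, the named fact at `κ = 8` is equivalent to the SLE₈ trace theorem**
`hasSLETrace_eight` (Lawler–Schramm–Werner (2004), Thm. 4.7): `→` holds outright
(`hasSLETrace_of_ae_isSpaceFilling_sleTrace_of_eight_le`), `←` is
`ae_isSpaceFilling_sleTrace_of_eight_le_of_cor35_of_hasSLETrace_eight`.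
[cite: RohdeSchramm2005, Cor. 7.4 and Update (p. 911)] -/
theorem ae_isSpaceFilling_sleTrace_of_eight_le_eight_iff_of_cor35
    (h35 : RohdeSchramm2005_cor35 Process.preWienerMeasure) :
    ae_isSpaceFilling_sleTrace_of_eight_le (κ := 8) ↔ hasSLETrace_eight :=
  ⟨fun h ↦ hasSLETrace_of_ae_isSpaceFilling_sleTrace_of_eight_le h le_rfl,
    fun h8e ↦ ae_isSpaceFilling_sleTrace_of_eight_le_of_cor35_of_hasSLETrace_eight h35 h8e⟩

/-- **Given Cor. 3.5, the named fact at every `κ` is equivalent to `hasSLETrace_eight`**: only its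
instance at `κ = 8` is not supplied by Cor. 3.5 itself.
[cite: RohdeSchramm2005, Cor. 7.4 and Update (p. 911)] -/
theorem forall_ae_isSpaceFilling_sleTrace_of_eight_le_iff_of_cor35
    (h35 : RohdeSchramm2005_cor35 Process.preWienerMeasure) :
    (∀ κ : ℝ≥0, ae_isSpaceFilling_sleTrace_of_eight_le (κ := κ)) ↔ hasSLETrace_eight :=
  ⟨fun h ↦ (ae_isSpaceFilling_sleTrace_of_eight_le_eight_iff_of_cor35 h35).1 (h 8),
    fun h8e _ ↦ ae_isSpaceFilling_sleTrace_of_eight_le_of_cor35_of_hasSLETrace_eight h35 h8e⟩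

/-- **Given Cor. 3.5, the named fact at every `κ` is equivalent to the transience fact**
`tendsto_norm_sleTrace_atTop` (Thm. 7.1 with the Update, every `κ > 0`): `→` through
`hasSLETrace_eight` and `tendsto_norm_sleTrace_atTop_of_cor35_of_eight`; `←` holds outright
(`ae_isSpaceFilling_sleTrace_of_eight_le_of_tendsto_norm_sleTrace_atTop`).
[cite: RohdeSchramm2005, Cor. 7.4, Thm 7.1 and Update (p. 911)] -/
theorem forall_ae_isSpaceFilling_sleTrace_of_eight_le_iff_tendsto_norm_sleTrace_atTop_of_cor35
    (h35 : RohdeSchramm2005_cor35 Process.preWienerMeasure) :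
    (∀ κ : ℝ≥0, ae_isSpaceFilling_sleTrace_of_eight_le (κ := κ)) ↔ tendsto_norm_sleTrace_atTop :=
  ⟨fun h ↦ tendsto_norm_sleTrace_atTop_of_cor35_of_eight h35
      ((forall_ae_isSpaceFilling_sleTrace_of_eight_le_iff_of_cor35 h35).1 h),
    fun htr _ ↦ ae_isSpaceFilling_sleTrace_of_eight_le_of_tendsto_norm_sleTrace_atTop htr⟩

/-- **Given Cor. 3.5, the named fact at every `κ` is equivalent to the existence of the chordal
SLE_κ curves in every Dobrushin domain** (`exists_isSLECurve`, itself equivalent to the transience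
fact outright, `tendsto_norm_sleTrace_atTop_iff_exists_isSLECurve`).
[cite: RohdeSchramm2005, Cor. 7.4, Thm 5.1 and Update (p. 911)] -/
theorem forall_ae_isSpaceFilling_sleTrace_of_eight_le_iff_exists_isSLECurve_of_cor35
    (h35 : RohdeSchramm2005_cor35 Process.preWienerMeasure) :
    (∀ κ : ℝ≥0, ae_isSpaceFilling_sleTrace_of_eight_le (κ := κ)) ↔ exists_isSLECurve :=
  (forall_ae_isSpaceFilling_sleTrace_of_eight_le_iff_tendsto_norm_sleTrace_atTop_of_cor35 h35).trans
    tendsto_norm_sleTrace_atTop_iff_exists_isSLECurve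

end Literature.Probability.RandomPlanarGeometry

end
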